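/-
Copyright: lit-balaban reader/typer seat r18 (gen 27).  Statement-level skeleton of a published paper; no proof claims beyond what the
kernel checks below.
-/
import Literature.MathematicalPhysics.QuantumFieldTheory.BalabanImbrieJaffe1984to88.BIJ88Sect3Translations
import Literature.MathematicalPhysics.QuantumFieldTheory.BalabanImbrieJaffe1984to88.BIJ88NeumannPropagator227Torus
import Literature.MathematicalPhysics.QuantumFieldTheory.BalabanImbrieJaffe1984to88.BIJ88Normalization49Torus
import Literature.MathematicalPhysics.QuantumFieldTheory.BalabanImbrieJaffe1984to88.BIJ88DeltaLoc234Torus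

/-!
# [BalabanImbrieJaffe1988] p. 270 (3.31) — the basic quadratic forms of the first step AT THE OBJECTS OF RECORD on the torus:
# `−Δ_{u₁} + aL⁻²Q(u₁)*Q(u₁)` = p31's whole-torus Neumann operator `nOp`, `Δ^L_{1,loc}(u₁)` = p31's `deltaLocT` at `k = 1`,
# and the first form = r18's (4.9)_{j=0} matrix `T49` in real coordinates

T. Bałaban, J. Imbrie, A. Jaffe, *Effective action and cluster properties of the abelian Higgs model*, Commun. Math. Phys. **114** (1988)
257–315 [BalabanImbrieJaffe1988], Sect. 3 p. 270 [PDF 14], verbatim (text layer `p0014.txt` L16–18, re-read gen 29): *"Neglecting terms at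
∂Λ₇^{(0)} and local terms [range O(r(e₀))] of the order of e^{−cr(e₀)}, we obtain the basic quadratic forms in φ^{(0)} and ψ: ½⟨φ^{(0)}, (−Δ_{u₁} +
aL^{−2}Q(u₁)*Q(u₁))φ^{(0)}⟩ + ½⟨Λ₈^{(0)′}ψ, Δ^L_{1,loc}(u₁)Λ₈^{(0)′}ψ⟩. (3.31)"*; the gloss of the prime is printed earlier, on p. 269 [PDF 13]
(text layer `p0013.txt` L29–33), after (3.27): *"If we neglect terms at ∂Λ₄^{(0)} and localized terms of the order of e^{−cr(e₀)}, we obtain the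
main quadratic forms for block and fluctuation fields: […] The prime denotes decimation (taking the corners of blocks only); the superscript
L indicates the block lattice spacing."* (v1.0 of this header had spliced the two sentences into one pseudo-quote — referee ref-5 D-g74-2,
corrected here; content unchanged); p. 275 [PDF 19] (4.9)–(4.10): *"Z^{(j)}_{Λ₁₀}(u_k) = ∫𝒟φ_{Λ₁₀} exp(−½⟨Λ₁₀φ,
(Δ^{L^jη}_{j,loc}(u_k) + aL⁻²P(u_k))Λ₁₀φ⟩ − E^{(j)}_{k,s}|Λ₁₀|), (4.9) with P(u_k) = Q(u_k)*Q(u_k), (4.10)"* (at `j = 0` the operator of (4.9)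
is the first form of (3.31)).

statement-level skeleton of published theorems with citation tags; proofs where landed; nothing here is a claim about the Yang–Mills mass gap

PDF held: `paper:balaban1988-cmp114-bij-abelian-higgs-effective-action` (journal page = PDF page + 256; p. 270 = PDF 14 `p0014.txt`, p. 269 =
PDF 13 `p0013.txt`).

v1.1 (r18 gen 29, literature-prover-lit-balaban-r18-g29-0, 2026-08-23; DOC-ONLY — every declaration byte-identical with v1.0 p365164 ✓ 0cc6ddf447bd):
(i) the p. 270 quotation corrected to the printed wording and the p. 269 gloss of the prime relocated (ref-5 D-g74-2); (ii) item (b) below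
updated: the derivation (3.29) → (3.30) → (3.31) that v1.0 recorded as NOT bridged IS NOW BRIDGED at these kernels by p29 gen 35's
`BIJ88BasicForms331OpsTorus.eq331_torus` / `eq331_record` (p369225 ✓ 6723474504a1, which imports this file; ROWS-C2 v2.106).

CITATION HEADER (lean-in-tree rule).  Part of the lit-balaban TYPED SKELETON (HOME `run/shared/lean/pub/lit-balaban/`), row **C2.Eq3.31**
of `HOME/lit-balaban-r18/ROWS-C2.md` (fold owner r18; unit `lit-balaban-r18`, gen 27; TAKING #2 line HOME/STATUS.md 2026-08-23T12:29Z).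
WHAT IS REPRODUCED, and how.  r18 gen 2's `BIJ88Sect3Translations.basicForms331 M Δloc Λ₈′ φ⁽⁰⁾ ψ` (p244472) types the display (3.31)
WITH BODY over the two kernels `M` (sites of `T₁`) and `Δloc` (block sites) as data.  The owner audit `HOME/lit-balaban-r18/AUDIT-C2S14-DEF-g26.md`
(row C2.Eq3.31) records that print's INSTANCE of those kernels was not identified by a kernel theorem.  THIS FILE identifies it, theorems
only: the first kernel is p31 gen 15's Neumann operator of the WHOLE fine torus `BIJ88NeumannPropagator227Torus.nOp a c u₁ 1 univ`
(`= (D_{u₁})ᴴD_{u₁} + a·Q(u₁)ᴴQ(u₁)` by `nOp_eq`; `a` stands for the printed `aL⁻²`, `c` for the lattice constant of `D_u`), whose quadratic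
form is LITERALLY `Σ_b ‖(D_{u₁}φ)(b)‖² + aΣ_y ‖(Q(u₁)φ)(y)‖²` (p31's `form_nPad` at `Ω = univ`, p11's `qCovK_one`: the one-step average
`Q(u₁)` of [2] (2.6) `BIJ85BlockAveragesTorus.qCov`); the second kernel is p31 gen 15's `BIJ88DeltaLoc234Torus.deltaLocT … u₁ 1 …`
(= (2.34) `Δ_{1,loc}(u₁)` on the block torus, row C2.Eq2.34 proved); and the first form is, in real coordinates, `½ vᵀT v` for r18 gen 7's
(4.9)_{j=0} matrix `BIJ88Normalization49Torus.T49 c a u₁` (`dot_T49_self`) — positive definite for every `U(1)` field (`T49_posDef`),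
with Gaussian integral `Z49_torus_eq`.  (a) PROVED: `sum_sum_conj_mul_eq` (the typed double sum `Σ_xΣ_y φ̄(x)M(x,y)φ(y)` is `φᴴ(Mφ)`),
`sum_sum_restrict_eq` (the `Λ₈′`-restricted double sum is the form at the restricted vector `Λ₈′ψ`), `cproj_univ` / `nPad_univ`
(no padding on the whole torus), `form_nOp_univ`, **`basicForms331_torus`** (the (3.31) display at `M = nOp a c u₁ 1 univ`, any `Δloc`,
EQUALS `½(Σ_b‖D_{u₁}φ⁽⁰⁾(b)‖² + aΣ_y‖(Q(u₁)φ⁽⁰⁾)(y)‖²) + ½Re⟨Λ₈′ψ, Δloc Λ₈′ψ⟩`), `basicForms331_torus_fst_nonneg`,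
**`re_form_nOp_univ_eq_dot_T49`** (bridge to `T49`), `basicForms331_torus_fst_pos` (the first form is `> 0` at `φ⁽⁰⁾ ≠ 0`), and the
instance line **`basicForms331_model`** at print's `Δ^L_{1,loc}(u₁) = deltaLocT a′ c u₁ 1 cube lam ζ″`.  (b) NOT asserted IN THIS FILE:
the derivation *"Neglecting terms at ∂Λ₇^{(0)} and local terms [range O(r(e₀))] of the order of e^{−cr(e₀)}, we obtain …"* ((3.29)–(3.30) ⟹
(3.31)) — it is p02 gen 5's `BIJ88BasicForms331.eq331` on the abstract `Ops` carrier (p256984); v1.1 note: SINCE BRIDGED to exactly these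
matrices by p29 gen 35's `BIJ88BasicForms331OpsTorus` (`ops330`, `ops330_laws`, `eq331_torus`, `eq331_record`; p369225), with the neglected
terms explicit (`negl331`); the sizes `e^{−cr(e₀)}` are not claimed there either.  Kind: theorems only (0 definitions, 0 `Prop`-valued facts;
D-0026).
-/

namespace Literature.MathematicalPhysics.QuantumFieldTheory.BalabanImbrieJaffe1984to88.BIJ88BasicForms331Torus

open Literature.MathematicalPhysics.QuantumFieldTheory.Balaban1983to89
open BIJ88Sect3Statements (U1 toC cfg covD starB mem_starB)
open BIJ88Sect3Translations (basicForms331)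
open BIJ85Sect1Model (HiggsField)
open BIJ85BlockAveragesTorus (qCov)
open BIJ85BlockAveragesTorusK (qCovK qCovK_one blockK)
open BIJ85ScalarPropagatorTorus (FineSp Dlin Qlin norm_Dlin_sq Qlin_apply)
open BIJ88NeumannNoZeroModesTorus (innerK mem_innerK)
open BIJ88NeumannPropagator227Torus (nOp nPad cproj form_nPad isUnit_nPad)
open BIJ88Normalization49Torus (Idx ofR T49 dot_T49_self T49_posDef)
open BIJ88DeltaLoc234Torus (deltaLocT)
open scoped BigOperators Matrix ComplexConjugate
open Finset Matrix

noncomputable section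

variable {P : Params} {j : ℕ}

/-! ## §1 Kernels: the typed double sums are sesquilinear forms -/

/-- kernel: `Σ_x Σ_y φ̄(x) M(x,y) φ(y) = φᴴ·(Mφ)` — the first double sum of `basicForms331` is the sesquilinear form of the kernel `M`.
[cite: BalabanImbrieJaffe1988, (3.31) p.270] -/
theorem sum_sum_conj_mul_eq {α : Type*} [Fintype α] (M : α → α → ℂ) (φ : α → ℂ) :
    ∑ x, ∑ y, (starRingEnd ℂ) (φ x) * M x y * φ y = star φ ⬝ᵥ ((M : Matrix α α ℂ) *ᵥ φ) := by
  simp only [dotProduct, mulVec, Pi.star_apply, Complex.star_def, Finset.mul_sum]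
  refine Finset.sum_congr rfl fun x _ => Finset.sum_congr rfl fun y _ => ?_
  ring

/-- kernel: the `Λ₈′`-restricted double sum `Σ_{x∈Λ} Σ_{y∈Λ} ψ̄(x) Δ(x,y) ψ(y)` is the form of `Δ` at the restricted vector `Λψ`
(*"½⟨Λ₈^{(0)′}ψ, Δ^L_{1,loc}(u₁)Λ₈^{(0)′}ψ⟩"* — the characteristic function `Λ₈′` multiplies `ψ`). [cite: BalabanImbrieJaffe1988, (3.31) p.270] -/
theorem sum_sum_restrict_eq {α : Type*} [Fintype α] [DecidableEq α] (Δ : α → α → ℂ) (Λ : Finset α) (ψ : α → ℂ) :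
    ∑ x ∈ Λ, ∑ y ∈ Λ, (starRingEnd ℂ) (ψ x) * Δ x y * ψ y =
      star (fun x => if x ∈ Λ then ψ x else 0) ⬝ᵥ ((Δ : Matrix α α ℂ) *ᵥ fun x => if x ∈ Λ then ψ x else 0) := by
  rw [← sum_sum_conj_mul_eq]
  rw [← Finset.sum_subset (Finset.subset_univ Λ)]
  · refine Finset.sum_congr rfl fun x hx => ?_
    rw [← Finset.sum_subset (Finset.subset_univ Λ)]
    · refine Finset.sum_congr rfl fun y hy => ?_
      simp only [hx, hy, if_true]
    · intro y _ hy
      simp only [hy, if_false, mul_zero]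
  · intro x _ hx
    refine Finset.sum_eq_zero fun y _ => ?_
    simp only [hx, if_false, map_zero, zero_mul]

/-- kernel: on the WHOLE torus there is no complementary projection: `1_{Tᶜ} = 0`. [cite: BalabanImbrieJaffe1988, (2.27) p.263] -/
theorem cproj_univ : cproj (Finset.univ : Finset (Balaban1983to89.Site P j)) = 0 := by
  unfold cproj
  ext x y
  by_cases h : x = y
  · subst h; simp
  · simp [Matrix.diagonal_apply_ne _ h]

/-- kernel: on the whole torus the padded Neumann operator IS the operator: `N = −Δ_{u} + aQ_k(u)*Q_k(u)` (`Ω = T`).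
[cite: BalabanImbrieJaffe1988, (2.27) p.263] -/
theorem nPad_univ (a c : ℝ) (U : GaugeField P j U1) (k : ℕ) :
    nPad a c U k (Finset.univ : Finset (Balaban1983to89.Site P j)) = nOp a c U k Finset.univ := by
  rw [nPad, cproj_univ, add_zero]

/-- **THE QUADRATIC FORM OF `−Δ_u + aQ_k(u)*Q_k(u)` ON THE WHOLE TORUS**: `φᴴ(−Δ_u + aQ_k^*Q_k)φ = Σ_b ‖(D_uφ)(b)‖² + a·Σ_y ‖(Q_k(u)φ)(y)‖²`
— p31's `form_nPad` at `Ω = univ` (every bond is in `T*`, every `k`-block lies in `T`, `Tᶜ = ∅`). [cite: BalabanImbrieJaffe1988, (3.31) p.270] -/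
theorem form_nOp_univ (a c : ℝ) (U : GaugeField P j U1) (k : ℕ) (φ : Balaban1983to89.Site P j → ℂ) :
    star φ ⬝ᵥ (nOp a c U k Finset.univ *ᵥ φ) =
      ((∑ b : PBond P j, ‖covD c (cfg U) φ b‖ ^ 2 + a * ∑ y : Balaban1983to89.Site P (j+k), ‖qCovK U k φ y‖ ^ 2 : ℝ) : ℂ) := by
  classical
  rw [← nPad_univ, form_nPad]
  have h1 : starB (Finset.univ : Finset (Balaban1983to89.Site P j)) = Finset.univ := by
    ext b; simp [mem_starB]
  have h2 : innerK k (Finset.univ : Finset (Balaban1983to89.Site P j)) = Finset.univ := by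
    ext y; simp [mem_innerK]
  rw [h1, h2, Finset.compl_univ, Finset.sum_empty, add_zero]

/-! ## §2 (3.31) at the objects of record -/

/-- **(3.31) AT THE OBJECTS OF RECORD.**  With `M := nOp a c u₁ 1 univ` (`−Δ_{u₁} + aQ(u₁)*Q(u₁)` on the whole fine torus `T₁`; `a` ↔ the
printed `aL⁻²`) and ANY block kernel `Δloc`, r18's typed display `basicForms331 M Δloc Λ₈′ φ⁽⁰⁾ ψ` EQUALS
`½(Σ_b ‖(D_{u₁}φ⁽⁰⁾)(b)‖² + a·Σ_y ‖(Q(u₁)φ⁽⁰⁾)(y)‖²) + ½·Re⟨Λ₈′ψ, Δloc Λ₈′ψ⟩` — the first summand is print's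
`½⟨φ⁽⁰⁾, (−Δ_{u₁} + aL⁻²Q(u₁)*Q(u₁))φ⁽⁰⁾⟩` with `Q(u₁)` the one-step average of [2] (2.6) (`qCov`). [cite: BalabanImbrieJaffe1988, (3.31) p.270] -/
theorem basicForms331_torus (a c : ℝ) (U : GaugeField P j U1) (Δloc : Balaban1983to89.Site P (j + 1) → Balaban1983to89.Site P (j + 1) → ℂ)
    (Λ₈' : Finset (Balaban1983to89.Site P (j + 1))) (φ0 : Balaban1983to89.Site P j → ℂ) (ψ : Balaban1983to89.Site P (j + 1) → ℂ) :
    basicForms331 (nOp a c U 1 Finset.univ) Δloc Λ₈' φ0 ψ =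
      (1 / 2) * (∑ b : PBond P j, ‖covD c (cfg U) φ0 b‖ ^ 2 + a * ∑ y : Balaban1983to89.Site P (j + 1), ‖qCov U φ0 y‖ ^ 2) +
        (1 / 2) * (star (fun x => if x ∈ Λ₈' then ψ x else 0) ⬝ᵥ
          ((Δloc : Matrix _ _ ℂ) *ᵥ fun x => if x ∈ Λ₈' then ψ x else 0)).re := by
  classical
  unfold basicForms331
  rw [sum_sum_conj_mul_eq, form_nOp_univ, Complex.ofReal_re, sum_sum_restrict_eq]
  simp only [qCovK_one]

/-- kernel: the first basic form is nonnegative. [cite: BalabanImbrieJaffe1988, (3.31) p.270] -/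
theorem basicForms331_torus_fst_nonneg (a c : ℝ) (ha : 0 ≤ a) (U : GaugeField P j U1) (φ0 : Balaban1983to89.Site P j → ℂ) :
    0 ≤ (1 / 2 : ℝ) * (∑ b : PBond P j, ‖covD c (cfg U) φ0 b‖ ^ 2 + a * ∑ y : Balaban1983to89.Site P (j + 1), ‖qCov U φ0 y‖ ^ 2) := by
  have h1 : 0 ≤ ∑ b : PBond P j, ‖covD c (cfg U) φ0 b‖ ^ 2 := Finset.sum_nonneg fun _ _ => by positivity
  have h2 : 0 ≤ ∑ y : Balaban1983to89.Site P (j + 1), ‖qCov U φ0 y‖ ^ 2 := Finset.sum_nonneg fun _ _ => by positivity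
  have h3 : 0 ≤ a * ∑ y : Balaban1983to89.Site P (j + 1), ‖qCov U φ0 y‖ ^ 2 := mul_nonneg ha h2
  positivity

/-! ## §3 The bridge to the (4.9)_{j=0} matrix `T49` in real coordinates -/

/-- **THE FIRST BASIC FORM IS r18's (4.9)_{j=0} MATRIX `T49` IN REAL COORDINATES**: for `φ = ofR v` (two real coordinates per site),
`Re φᴴ(−Δ_{u} + aQ(u)*Q(u))φ = vᵀ T49 v` (`= ‖D_uφ‖² + a‖Q(u)φ‖²`, p11's `Dlin`/`Qlin`; `dot_T49_self`). [cite: BalabanImbrieJaffe1988, (4.9) p.275] -/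
theorem re_form_nOp_univ_eq_dot_T49 (c a : ℝ) (U : GaugeField P j U1) (v : Idx P j → ℝ) :
    (star (WithLp.ofLp (ofR v)) ⬝ᵥ (nOp a c U 1 Finset.univ *ᵥ WithLp.ofLp (ofR v))).re = v ⬝ᵥ (T49 c a U *ᵥ v) := by
  rw [form_nOp_univ, Complex.ofReal_re, dot_T49_self, norm_Dlin_sq, PiLp.norm_sq_eq_of_L2]
  simp only [qCovK_one, Qlin_apply, covD]
  rfl

/-- **THE FIRST BASIC FORM IS POSITIVE DEFINITE** on the whole torus for every `U(1)` field `u₁`, every `a > 0`, `c ≠ 0` (standing range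
`j + 1 ≤ m + K`): `Σ_b‖D_{u₁}φ⁽⁰⁾‖² + aΣ_y‖Q(u₁)φ⁽⁰⁾‖² > 0` for `φ⁽⁰⁾ ≠ 0` — via the bridge and r18's `T49_posDef` (p11's `hpos_torus`);
hence its Gaussian integral is (4.9) at `j = 0`, `Z49_torus_eq`. [cite: BalabanImbrieJaffe1988, (3.31) p.270] -/
theorem basicForms331_torus_fst_pos (hj : j + 1 ≤ P.m + P.K) {c : ℝ} (hc : c ≠ 0) {a : ℝ} (ha : 0 < a) (U : GaugeField P j U1)
    (v : Idx P j → ℝ) (hv : v ≠ 0) :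
    0 < (star (WithLp.ofLp (ofR v)) ⬝ᵥ (nOp a c U 1 Finset.univ *ᵥ WithLp.ofLp (ofR v))).re := by
  rw [re_form_nOp_univ_eq_dot_T49]
  have h := (Matrix.posDef_iff_dotProduct_mulVec.1 (T49_posDef hj hc ha U)).2 hv
  rwa [star_trivial] at h

/-! ## §4 Print's instance of the second kernel: `Δ^L_{1,loc}(u₁) = deltaLocT` at `k = 1` -/

/-- **(3.31) AT PRINT'S `Δ^L_{1,loc}(u₁)`** — the second kernel instantiated at p31's torus `Δ_{k,loc}(u)` of (2.34) with `k = 1` and the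
(2.27) data (`cube`, `lam`, cut-off `ζ″`): the typed display equals `½(Σ_b ‖D_{u₁}φ⁽⁰⁾‖² + aΣ_y ‖Q(u₁)φ⁽⁰⁾‖²) +
½Re⟨Λ₈′ψ, Δ_{1,loc}(u₁)Λ₈′ψ⟩`. [cite: BalabanImbrieJaffe1988, (3.31) p.270] -/
theorem basicForms331_model {ι : Type*} [Fintype ι] (a c a' c' : ℝ) (U : GaugeField P j U1)
    (cube : ι → Finset (Balaban1983to89.Site P j)) (lam : ι → Balaban1983to89.Site P j → Balaban1983to89.Site P j → ℝ)
    (ζ'' : Balaban1983to89.Site P j → Balaban1983to89.Site P j → ℝ)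
    (Λ₈' : Finset (Balaban1983to89.Site P (j + 1))) (φ0 : Balaban1983to89.Site P j → ℂ) (ψ : Balaban1983to89.Site P (j + 1) → ℂ) :
    basicForms331 (nOp a c U 1 Finset.univ) (deltaLocT a' c' U 1 cube lam ζ'') Λ₈' φ0 ψ =
      (1 / 2) * (∑ b : PBond P j, ‖covD c (cfg U) φ0 b‖ ^ 2 + a * ∑ y : Balaban1983to89.Site P (j + 1), ‖qCov U φ0 y‖ ^ 2) +
        (1 / 2) * (star (fun x => if x ∈ Λ₈' then ψ x else 0) ⬝ᵥ
          (deltaLocT a' c' U 1 cube lam ζ'' *ᵥ fun x => if x ∈ Λ₈' then ψ x else 0)).re :=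
  basicForms331_torus a c U _ Λ₈' φ0 ψ

end

end Literature.MathematicalPhysics.QuantumFieldTheory.BalabanImbrieJaffe1984to88.BIJ88BasicForms331Torus
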